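import Summits.ValiantsHypothesis.ValiantsHypothesis.Theorems.NewtonUnitEquationsTwoProductsPresentationBootstrap
import Summits.ValiantsHypothesis.ValiantsHypothesis.Theorems.NewtonTauWeak.Negative.Zonogon

/-!
# Crux `TwoProducts` (stmt-ValiantsHypothesis-5906) — idea `presentation-bootstrap` PORTED, part 2/2: the crux is EQUIVALENT to the
# polynomial bound `#vert ≤ (t+2)^b` in the exponential regime `t ≥ 2^(κ m)`, and the fixed-sparsity sub-exponential corollary
Verbatim continuation of val-idea-35's sorry-free sketch `pub/ideators/val-idea-35/PresentationBootstrap.lean` rev 3 (sha16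
bb1b1633d2042f36; split in two only because Theorems proof files are ≤ 400 lines; porter val-port-1 g2, desk g13 RULING #310 (C)):
`PolyInExpRegime`, `polyInExpRegime_of_twoProducts` (`κ ≥ 1`), `twoProducts_of_polyInExpRegime` (every `κ`; re-blocking + padding),
`boundedSparsitySubexp_of_twoProducts`.  SCOPE LABEL: **reformulation + refutation criterion; closes nothing** — helper
(`--supports stmt-ValiantsHypothesis-5906 --as helper`); `TwoProducts` (5906) OPEN; VP ≠ VNP is NOT proved.
-/

set_option linter.dupNamespace false

namespace Summit.ValiantsHypothesis.ValiantsHypothesis.Theorems.NewtonUnitEquations.TwoProducts.PresentationBootstrap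


open scoped BigOperators Pointwise
open Summit.ValiantsHypothesis.ValiantsHypothesis.Theses.NewtonUnitEquations (TwoProducts)

/-- The crux restricted to the regime `t ≥ 2^(κ m)`, with a purely POLYNOMIAL allowance `(t+2)^b`. -/
def PolyInExpRegime (κ : ℕ) : Prop :=
  ∃ b : ℕ, ∀ (m t : ℕ) (f g : Fin m → MvPolynomial (Fin 2) ℂ), 2 ^ (κ * m) ≤ t →
    (∀ j, (f j).support.card ≤ t) → (∀ j, (g j).support.card ≤ t) →
      vert (∏ j, f j - ∏ j, g j) ≤ (t + 2) ^ b

/-- easy direction: in the regime, `2^(a m) ≤ t^a`. -/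
theorem polyInExpRegime_of_twoProducts (κ : ℕ) (hκ : 1 ≤ κ) : TwoProducts → PolyInExpRegime κ := by
  rintro ⟨a, b, hab⟩
  refine ⟨a + b, fun m t f g ht hf hg => ?_⟩
  have h1 := hab m t f g hf hg
  have h2 : 2 ^ (a * m) ≤ (t + 2) ^ a := by
    have h3 : 2 ^ m ≤ t + 2 := by
      calc 2 ^ m = 2 ^ (1 * m) := by rw [one_mul]
        _ ≤ 2 ^ (κ * m) := Nat.pow_le_pow_right (by norm_num) (Nat.mul_le_mul_right m hκ)
        _ ≤ t := ht
        _ ≤ t + 2 := Nat.le_add_right t 2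
    calc 2 ^ (a * m) = (2 ^ m) ^ a := by rw [mul_comm, pow_mul]
      _ ≤ (t + 2) ^ a := Nat.pow_le_pow_left h3 a
  calc vert (∏ j, f j - ∏ j, g j) ≤ 2 ^ (a * m) * (t + 2) ^ b := h1
    _ ≤ (t + 2) ^ a * (t + 2) ^ b := Nat.mul_le_mul_right _ h2
    _ = (t + 2) ^ (a + b) := (pow_add _ _ _).symm

/-- Sparsity of a product of `m` factors of sparsity `≤ t`. -/
theorem card_support_prod_sub_le {m t : ℕ} (f g : Fin m → MvPolynomial (Fin 2) ℂ)
    (hf : ∀ i, (f i).support.card ≤ t) (hg : ∀ i, (g i).support.card ≤ t) :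
    (∏ i, f i - ∏ i, g i).support.card ≤ t ^ m + t ^ m := by
  classical
  calc (∏ i, f i - ∏ i, g i).support.card ≤ ((∏ i, f i).support ∪ (∏ i, g i).support).card :=
        Finset.card_le_card (MvPolynomial.support_sub _ _ _)
    _ ≤ (∏ i, f i).support.card + (∏ i, g i).support.card := Finset.card_union_le _ _
    _ ≤ t ^ m + t ^ m := by
        have h1 := card_support_prod_le (Finset.univ : Finset (Fin m)) t f (fun i _ => hf i)
        have h2 := card_support_prod_le (Finset.univ : Finset (Fin m)) t g (fun i _ => hg i)
        simp only [Finset.card_univ, Fintype.card_fin] at h1 h2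
        exact Nat.add_le_add h1 h2

/-- Re-blocking a padded family: `k` blocks of `r` factors, block sparsity `≤ t^r`, same product. -/
theorem exists_reblock {m k r t : ℕ} (hmN : m ≤ k * r) (ht : 1 ≤ t) (f : Fin m → MvPolynomial (Fin 2) ℂ)
    (hf : ∀ i, (f i).support.card ≤ t) :
    ∃ F : Fin k → MvPolynomial (Fin 2) ℂ, (∀ j, (F j).support.card ≤ t ^ r) ∧ ∏ j, F j = ∏ i, f i := by
  classical
  refine ⟨fun j => ∏ i : Fin r, pad f (k * r) (finProdFinEquiv (j, i)), fun j => ?_, ?_⟩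
  · simpa using card_support_prod_le (Finset.univ : Finset (Fin r)) t
      (fun i => pad f (k * r) (finProdFinEquiv (j, i))) (fun i _ => card_support_pad_le ht f hf _ _)
  · show (∏ j : Fin k, ∏ i : Fin r, pad f (k * r) (finProdFinEquiv (j, i))) = ∏ i, f i
    rw [prod_blocks k r (pad f (k * r)), prod_pad hmN]

/-- Applying the regime hypothesis to a re-blocked instance. -/
theorem reblock_apply {κ b m t r k L : ℕ}
    (hb : ∀ (m t : ℕ) (f g : Fin m → MvPolynomial (Fin 2) ℂ), 2 ^ (κ * m) ≤ t →
      (∀ j, (f j).support.card ≤ t) → (∀ j, (g j).support.card ≤ t) →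
        vert (∏ j, f j - ∏ j, g j) ≤ (t + 2) ^ b)
    (ht1 : 1 ≤ t) (h2L : 2 ^ L ≤ t) (hmk : m ≤ k * r) (hκ : κ * k ≤ r * L)
    (f g : Fin m → MvPolynomial (Fin 2) ℂ) (hf : ∀ i, (f i).support.card ≤ t)
    (hg : ∀ i, (g i).support.card ≤ t) :
    vert (∏ j, f j - ∏ j, g j) ≤ (t ^ r + 2) ^ b := by
  obtain ⟨F, hF, hFp⟩ := exists_reblock (k := k) (r := r) hmk ht1 f hf
  obtain ⟨G, hG, hGp⟩ := exists_reblock (k := k) (r := r) hmk ht1 g hg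
  have hreg : 2 ^ (κ * k) ≤ t ^ r :=
    calc 2 ^ (κ * k) ≤ 2 ^ (r * L) := Nat.pow_le_pow_right (by norm_num) hκ
      _ = (2 ^ L) ^ r := by rw [show r * L = L * r from mul_comm _ _, pow_mul]
      _ ≤ t ^ r := Nat.pow_le_pow_left h2L r
  have key := hb k (t ^ r) F G hreg hF hG
  rwa [hFp, hGp] at key

/-- The common finishing step of the three regimes. -/
theorem regime_finish {V X b κ m t : ℕ} (hV : V ≤ X ^ b) (hX : X ≤ (t + 2) ^ (2 * κ + 1) * 2 ^ (2 * m)) :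
    V ≤ 2 ^ (2 * b * m) * (t + 2) ^ ((2 * κ + 3) * b + 1) := by
  have hT1 : 1 ≤ t + 2 := by omega
  calc V ≤ X ^ b := hV
    _ ≤ ((t + 2) ^ (2 * κ + 1) * 2 ^ (2 * m)) ^ b := Nat.pow_le_pow_left hX b
    _ = (t + 2) ^ ((2 * κ + 1) * b) * 2 ^ (2 * b * m) := by
        rw [mul_pow, ← pow_mul, ← pow_mul, show 2 * m * b = 2 * b * m by ring]
    _ ≤ (t + 2) ^ ((2 * κ + 3) * b + 1) * 2 ^ (2 * b * m) :=
        Nat.mul_le_mul_right _ (Nat.pow_le_pow_right hT1 (by nlinarith))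
    _ = 2 ^ (2 * b * m) * (t + 2) ^ ((2 * κ + 3) * b + 1) := mul_comm _ _

/-- REGIME REDUCTION (PROVED): a polynomial bound in the regime `t ≥ 2^(κ m)` already gives the crux.  Three
regimes for `t ≥ 2`, `L = ⌊log₂ t⌋`: (i) `2^(κm) ≤ t`: the hypothesis itself; (ii) `m ≥ κ(L+1)`: re-block into
`k = m/r + 1` blocks of `r = m/L + 1` factors (`t^r ≤ t·2^(2m)`); (iii) otherwise `r = 2κ`; and `t ≤ 1` is trivial
(`#vert ≤ #supp ≤ 2`).  Constants: `(a', b') = (2b, (2κ+3)b + 1)`. -/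
theorem twoProducts_of_polyInExpRegime (κ : ℕ) : PolyInExpRegime κ → TwoProducts := by
  rintro ⟨b, hb⟩
  refine ⟨2 * b, (2 * κ + 3) * b + 1, fun m t f g hf hg => ?_⟩
  show vert (∏ j, f j - ∏ j, g j) ≤ 2 ^ (2 * b * m) * (t + 2) ^ ((2 * κ + 3) * b + 1)
  have hT1 : 1 ≤ t + 2 := by omega
  have h2pos : 1 ≤ 2 ^ (2 * m) := Nat.one_le_two_pow
  rcases Nat.lt_or_ge t 2 with ht | ht
  · -- t ≤ 1 : at most two monomials survive
    have hsmall : vert (∏ j, f j - ∏ j, g j) ≤ 2 := by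
      calc vert (∏ j, f j - ∏ j, g j) ≤ (∏ j, f j - ∏ j, g j).support.card :=
          (Summit.ValiantsHypothesis.ValiantsHypothesis.Theorems.NewtonTauWeak.Negative.vert_le_card_support _)
        _ ≤ t ^ m + t ^ m := card_support_prod_sub_le f g hf hg
        _ ≤ 1 ^ m + 1 ^ m :=
            Nat.add_le_add (Nat.pow_le_pow_left (by omega) m) (Nat.pow_le_pow_left (by omega) m)
        _ = 2 := by simp
    calc vert (∏ j, f j - ∏ j, g j) ≤ 2 := hsmall
      _ ≤ (t + 2) ^ 1 := by simp
      _ ≤ (t + 2) ^ ((2 * κ + 3) * b + 1) := Nat.pow_le_pow_right hT1 (by omega)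
      _ ≤ 2 ^ (2 * b * m) * (t + 2) ^ ((2 * κ + 3) * b + 1) := Nat.le_mul_of_pos_left _ (by positivity)
  -- t ≥ 2
  set L := Nat.log 2 t with hL
  have hL1 : 1 ≤ L := Nat.log_pos (by norm_num) ht
  have h2L : 2 ^ L ≤ t := Nat.pow_log_le_self 2 (by omega)
  have htL : t < 2 ^ (L + 1) := Nat.lt_pow_succ_log_self (by norm_num) t
  have ht1 : 1 ≤ t := by omega
  have hX1 : t + 2 ≤ (t + 2) ^ (2 * κ + 1) * 2 ^ (2 * m) :=
    calc t + 2 = (t + 2) ^ 1 := (pow_one _).symm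
      _ ≤ (t + 2) ^ (2 * κ + 1) := Nat.pow_le_pow_right hT1 (by omega)
      _ ≤ (t + 2) ^ (2 * κ + 1) * 2 ^ (2 * m) := Nat.le_mul_of_pos_right _ (by positivity)
  by_cases hreg : 2 ^ (κ * m) ≤ t
  · -- (i) inside the regime
    exact regime_finish (hb m t f g hreg hf hg) hX1
  have hκ1 : 1 ≤ κ := by
    rcases Nat.eq_zero_or_pos κ with h0 | h0
    · exact absurd (by rw [h0, zero_mul, pow_zero]; exact ht1) hreg
    · exact h0
  by_cases hm : κ * (L + 1) ≤ m
  · -- (ii) many factors: r = m / L + 1, k = m / r + 1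
    set r := m / L + 1 with hr
    have hrpos : 0 < r := Nat.succ_pos _
    set k := m / r + 1 with hk
    have hmk : m ≤ k * r := by
      have := Nat.lt_div_mul_add (a := m) hrpos
      rw [hk, add_mul, one_mul]; exact this.le
    have hmrL : m ≤ r * L := by
      have := Nat.lt_div_mul_add (a := m) (show 0 < L by omega)
      rw [hr, add_mul, one_mul]; exact this.le
    have hdiv : m / r ≤ L := Nat.div_le_of_le_mul hmrL
    have hκk : κ * k ≤ r * L :=
      calc κ * k = κ * (m / r + 1) := by rw [hk]
        _ ≤ κ * (L + 1) := Nat.mul_le_mul_left κ (by omega)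
        _ ≤ m := hm
        _ ≤ r * L := hmrL
    have hV := reblock_apply hb ht1 h2L hmk hκk f g hf hg
    have hq : L * (m / L) ≤ m := Nat.mul_div_le m L
    have hq2 : m / L ≤ L * (m / L) := Nat.le_mul_of_pos_left _ (by omega)
    have hexp : (L + 1) * (m / L) ≤ 2 * m := by
      calc (L + 1) * (m / L) = L * (m / L) + m / L := by ring
        _ ≤ L * (m / L) + L * (m / L) := Nat.add_le_add_left hq2 _
        _ ≤ m + m := Nat.add_le_add hq hq
        _ = 2 * m := by ring
    have htpow : t ^ (m / L) ≤ 2 ^ (2 * m) :=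
      calc t ^ (m / L) ≤ (2 ^ (L + 1)) ^ (m / L) := Nat.pow_le_pow_left htL.le _
        _ = 2 ^ ((L + 1) * (m / L)) := by rw [← pow_mul]
        _ ≤ 2 ^ (2 * m) := Nat.pow_le_pow_right (by norm_num) hexp
    have hX : t ^ r + 2 ≤ (t + 2) ^ (2 * κ + 1) * 2 ^ (2 * m) :=
      calc t ^ r + 2 = t ^ (m / L) * t + 2 := by rw [hr, pow_succ]
        _ ≤ 2 ^ (2 * m) * t + 2 ^ (2 * m) * 2 := by
            have := Nat.mul_le_mul_right t htpow
            nlinarith [this, h2pos]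
        _ = 2 ^ (2 * m) * (t + 2) := by ring
        _ ≤ 2 ^ (2 * m) * ((t + 2) ^ (2 * κ + 1)) :=
            Nat.mul_le_mul_left _ (by
              calc t + 2 = (t + 2) ^ 1 := (pow_one _).symm
                _ ≤ (t + 2) ^ (2 * κ + 1) := Nat.pow_le_pow_right hT1 (by omega))
        _ = (t + 2) ^ (2 * κ + 1) * 2 ^ (2 * m) := mul_comm _ _
    exact regime_finish hV hX
  · -- (iii) the gap `log₂ t / κ < m < κ (L+1)`: r = 2κ, k = m / r + 1
    push Not at hm
    set r := κ * 2 with hr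
    have hrpos : 0 < r := by omega
    set k := m / r + 1 with hk
    have hmk : m ≤ k * r := by
      have := Nat.lt_div_mul_add (a := m) hrpos
      rw [hk, add_mul, one_mul]; exact this.le
    have hdiv : m / r ≤ (L + 1) / 2 := by
      calc m / r ≤ (κ * (L + 1)) / r := Nat.div_le_div_right hm.le
        _ = (L + 1) / 2 := by rw [hr]; exact Nat.mul_div_mul_left (L + 1) 2 (by omega)
    have hk2 : k ≤ 2 * L := by rw [hk]; omega
    have hκk : κ * k ≤ r * L :=
      calc κ * k ≤ κ * (2 * L) := Nat.mul_le_mul_left κ hk2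
        _ = r * L := by rw [hr]; ring
    have hV := reblock_apply hb ht1 h2L hmk hκk f g hf hg
    have hP1 : 1 ≤ (t + 2) ^ r := Nat.one_le_pow _ _ (by omega)
    have hX : t ^ r + 2 ≤ (t + 2) ^ (2 * κ + 1) * 2 ^ (2 * m) :=
      calc t ^ r + 2 ≤ (t + 2) ^ r + 2 := Nat.add_le_add_right (Nat.pow_le_pow_left (by omega) r) 2
        _ ≤ (t + 2) ^ r * (t + 2) := by nlinarith [hP1, hT1]
        _ = (t + 2) ^ (2 * κ + 1) := by rw [← pow_succ, hr, mul_comm κ 2]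
        _ ≤ (t + 2) ^ (2 * κ + 1) * 2 ^ (2 * m) := Nat.le_mul_of_pos_right _ (by positivity)
    exact regime_finish hV hX

/-- BOUNDED SPARSITY COROLLARY (PROVED): `TwoProducts` forces `2^{O_s(√M)}` vertex growth for two products of
`M` factors of sparsity `≤ s` (re-block into `M/R + 1` blocks of `R = √M + 1` padded factors). -/
theorem boundedSparsitySubexp_of_twoProducts : TwoProducts → BoundedSparsitySubexp := by
  intro hTP s
  obtain ⟨a, b, hB⟩ := blockBound_of_twoProducts hTP
  rcases Nat.eq_zero_or_pos s with hs0 | hs1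
  · refine ⟨1, fun M f g hf hg => ?_⟩
    subst hs0
    calc vert (∏ i, f i - ∏ i, g i) ≤ (∏ i, f i - ∏ i, g i).support.card :=
          (Summit.ValiantsHypothesis.ValiantsHypothesis.Theorems.NewtonTauWeak.Negative.vert_le_card_support _)
      _ ≤ 0 ^ M + 0 ^ M := card_support_prod_sub_le f g hf hg
      _ ≤ 1 ^ M + 1 ^ M :=
          Nat.add_le_add (Nat.pow_le_pow_left (by omega) M) (Nat.pow_le_pow_left (by omega) M)
      _ = 2 ^ 1 := by simp
      _ ≤ 2 ^ (1 * (Nat.sqrt M + 1)) := Nat.pow_le_pow_right (by norm_num) (by omega)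
  · refine ⟨a + (s + 2) * b, fun M f g hf hg => ?_⟩
    set R := Nat.sqrt M + 1 with hR
    have hRpos : 0 < R := Nat.succ_pos _
    set k := M / R + 1 with hk
    have hMk : M ≤ k * R := by
      have := Nat.lt_div_mul_add (a := M) hRpos
      rw [hk, add_mul, one_mul]; exact this.le
    have hdiv : M / R < R := (Nat.div_lt_iff_lt_mul hRpos).2 (Nat.lt_succ_sqrt M)
    have hkR : k ≤ R := by rw [hk]; omega
    have key := hB k R s (pad f (k * R)) (pad g (k * R))
      (card_support_pad_le hs1 f hf _) (card_support_pad_le hs1 g hg _)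
    rw [prod_pad hMk, prod_pad hMk] at key
    have hs2 : s + 2 ≤ 2 ^ (s + 2) := (@Nat.lt_two_pow_self (s + 2)).le
    have h22 : 2 ≤ 2 ^ R := by
      calc 2 = 2 ^ 1 := by norm_num
        _ ≤ 2 ^ R := Nat.pow_le_pow_right (by norm_num) hRpos
    have hsR : s ^ R + 2 ≤ 2 ^ ((s + 2) * R) :=
      calc s ^ R + 2 ≤ s ^ R + 2 ^ R := Nat.add_le_add_left h22 _
        _ ≤ (s + 2) ^ R := pow_add_pow_le (by omega) (by omega) hRpos.ne'
        _ ≤ (2 ^ (s + 2)) ^ R := Nat.pow_le_pow_left hs2 R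
        _ = 2 ^ ((s + 2) * R) := by rw [← pow_mul]
    calc vert (∏ i, f i - ∏ i, g i) ≤ 2 ^ (a * k) * (s ^ R + 2) ^ b := key
      _ ≤ 2 ^ (a * R) * (2 ^ ((s + 2) * R)) ^ b :=
          Nat.mul_le_mul (Nat.pow_le_pow_right (by norm_num) (Nat.mul_le_mul_left a hkR))
            (Nat.pow_le_pow_left hsR b)
      _ = 2 ^ ((a + (s + 2) * b) * R) := by rw [← pow_mul, ← pow_add]; ring_nf

end Summit.ValiantsHypothesis.ValiantsHypothesis.Theorems.NewtonUnitEquations.TwoProducts.PresentationBootstrap
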